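import Mathlib.AlgebraicGeometry.Sites.ElladicCohomology
import Mathlib.CategoryTheory.Sites.LocallyBijective
import Mathlib.Algebra.Category.Grp.AB
import Literature.AlgebraicGeometry.Motives.EllAdicCohomologyFiniteness
import HarnessLib

/-!
# The constant pro-étale sheaf of a discrete group is the sheaf of locally constant maps
# (Bhatt–Scholze, Lemma 4.2.12), and `Hⁱ(X_proét, F_M) = Hⁱ(X_proét, M)`

Bhatt–Scholze, *The pro-étale topology for schemes*, Lemma 4.2.12: "The association mapping any
`U ∈ X_proét` to `Map_cont(U, T)` is a sheaf `F_T` on `X_proét`. [...] In particular, if `T` is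
discrete, then `F_T` is the constant sheaf associated with `T`." The first sentence is Mathlib's
`Scheme.ellAdicSheaf` construction, recorded for a general topological abelian group `A` as
`Literature.AlgebraicGeometry.Motives.continuousMapProetSheaf X A` (`EllAdicCohomologyFiniteness.lean`).
This file **proves the last sentence** on Mathlib's carriers and draws the consequence for
cohomology:

* `constantSheafIsoContinuousMapProetSheaf X M` : for a *discrete* abelian group `M`, the constant
  sheaf `M_X` on the small pro-étale site (Mathlib `constantSheaf (ProEt.topology X) Ab.{u+1}`
  applied to `ULift M`, i.e. the sheafification of the constant presheaf) is canonically
  isomorphic to `F_M : U ↦ C(U, M)` (lifted to `Ab.{u+1}`, as in Mathlib's `EllAdicCohomology`);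
* `proetCohomologyEquivConstantSheafH X M i : Hⁱ(X_proét, F_M) ≃+ Hⁱ(X_proét, M_X)` : the
  pro-étale cohomology with coefficients `F_M` of `EllAdicCohomologyFiniteness.lean`
  (`ProetCohomology X M i`) *is* the cohomology of the constant sheaf — the form in which the
  comparison theorems of Bhatt–Scholze §5 (`ν*` of a constant étale sheaf is the constant
  pro-étale sheaf; Cor. 5.1.6, Cor. 5.1.9) speak about it. This discharges the "Lemma 4.2.12" half
  of the bridge fact `nonempty_addEquiv_proetCohomology_etaleCohomology`
  (`EllAdicCohomologyFinitenessEtale.lean`); the étale half and the residual Cor. 5.1.9 statement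
  are in `ConstantEtaleSheaf.lean`.

## Proof

The morphism of presheaves `M → F_M(U)`, `m ↦ (constant map m)` (`constToContinuousMapProetSheaf`)
is *locally bijective* for the pro-étale topology: locally injective because two constants with
the same constant map agree as soon as `U ≠ ∅`, while the empty scheme is covered by the empty
family (Mathlib `Scheme.ProEt.bot_mem_topology`); locally surjective because a continuous
`f : U → M` is constant on each fibre `f⁻¹(m)`, and the open immersions `f⁻¹(m) ↪ U` form a
Zariski, hence pro-étale, covering of `U` in `X_proét` (`ofArrows_proetOfOpensι_mem`). A locally
bijective morphism into a sheaf induces an isomorphism from the sheafification (Mathlib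
`GrothendieckTopology.W_of_isLocallyBijective`, `W_iff`, `sheafificationIso`). Cohomology
(`Sheaf.H = Extⁱ(ℤ, –)`) is functorial in the sheaf (`Sheaf.H.map`), whence the `≃+`.

## References

* B. Bhatt, P. Scholze, *The pro-étale topology for schemes*, Astérisque 369 (2015)
  (arXiv:1309.1198): Def. 4.1.1 (the site; covers are fpqc covers, so Zariski covers are covers),
  Lemma 4.1.8, Lemma 4.2.12, Def. 6.8.1. [BhattScholze2015]

## Design notes

* Everything is on Mathlib's `X.ProEt` (`MorphismProperty.Over @WeaklyEtale ⊤ X`) with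
  `Scheme.ProEt.topology`, coefficients in `Ab.{u+1}` exactly as `Scheme.EllAdicCohomology` /
  `ProetCohomology` (the sheaf `F_M` is `(sheafCompose _ uliftFunctor.{u+1}).obj
  (continuousMapProetSheaf X M)`, whose value at `U` is `ULift C(U.left, M)` by `rfl`).
* `proetOfOpens U W` / `proetOfOpensι U W`: an open `W ⊆ U` of an object `U` of `X_proét` as an
  object over `U` (open immersions are weakly étale and weakly étale maps compose; membership is
  given by `MorphismProperty.comp_mem` explicitly).
* The isomorphism is canonical data (`def`s); `addEquivHOfIso` is the evident transport of
  `Sheaf.H` along an isomorphism of sheaves (Mathlib has `Sheaf.H.map` but no packaged `mapIso`).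
* Mathlib searches: `constantSheaf`, `Sheaf.isConstant_iff_*` (abstract constancy API, no link to
  `C(U, M)`); `continuousMapPresheafEquivOfTotallyDisconnectedSpace` (`C(U, T) = C(π₀ U, T)`, the
  middle sentence of Lemma 4.2.12 for the presheaf); the TODO "When `T` is discrete, this is the
  constant sheaf associated to `T`" in `Mathlib/AlgebraicGeometry/Sites/ConstantSheaf.lean` is what
  is proved here for the small pro-étale site. Nothing restated.
-/

universe w' w u

open CategoryTheory Limits Opposite AlgebraicGeometry

noncomputable section

namespace Literature.AlgebraicGeometry.Motives

/-! ### Transport of sheaf cohomology along an isomorphism of sheaves -/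

section Transport

variable {C : Type*} [Category C] {J : GrothendieckTopology C}
  [HasSheafify J AddCommGrpCat.{w}] [HasExt.{w'} (Sheaf J AddCommGrpCat.{w})]

/-- Isomorphic abelian sheaves have isomorphic cohomology: `Hⁿ(F) ≃+ Hⁿ(G)` for `e : F ≅ G`
(functoriality of Mathlib's `Sheaf.H = Extⁿ(ℤ, –)`, `Sheaf.H.map`). [folklore] -/
def addEquivHOfIso {F G : Sheaf J AddCommGrpCat.{w}} (e : F ≅ G) (n : ℕ) :
    F.H n ≃+ G.H n where
  toFun := Sheaf.H.map e.hom n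
  invFun := Sheaf.H.map e.inv n
  left_inv x := by rw [← Sheaf.H.map_comp_apply, Iso.hom_inv_id, Sheaf.H.map_id_apply]
  right_inv x := by rw [← Sheaf.H.map_comp_apply, Iso.inv_hom_id, Sheaf.H.map_id_apply]
  map_add' x y := map_add _ _ _

/-- `addEquivHOfIso e n` is `Sheaf.H.map e.hom n` on elements. [folklore] -/
@[simp] theorem addEquivHOfIso_apply {F G : Sheaf J AddCommGrpCat.{w}} (e : F ≅ G) (n : ℕ)
    (x : F.H n) : addEquivHOfIso e n x = Sheaf.H.map e.hom n x := rfl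

end Transport

/-! ### Opens of an object of `X_proét` and the Zariski covers they generate -/

section Opens

variable {X : Scheme.{u}}

/-- An open subscheme `W ⊆ U` of a weakly étale `X`-scheme `U`, as an object of `X_proét`
(`W ↪ U → X` is weakly étale: open immersions are (weakly) étale and weakly étale maps compose,
Bhatt–Scholze Lemma 4.1.6). [cite: BhattScholze2015, Lemma 4.1.6] -/
def proetOfOpens (U : X.ProEt) (W : U.left.Opens) : X.ProEt :=
  MorphismProperty.Over.mk ⊤ (W.ι ≫ U.hom)
    (MorphismProperty.comp_mem _ _ _ (inferInstance : WeaklyEtale W.ι) U.prop)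

/-- The open immersion `W ↪ U` as a morphism of `X_proét`. [folklore] -/
def proetOfOpensι (U : X.ProEt) (W : U.left.Opens) : proetOfOpens U W ⟶ U :=
  MorphismProperty.Over.homMk W.ι rfl

/-- The underlying morphism of schemes of `proetOfOpensι U W` is the open immersion `W.ι`
(by `rfl`). [folklore] -/
@[simp] theorem proetOfOpensι_left (U : X.ProEt) (W : U.left.Opens) :
    (proetOfOpensι U W).left = W.ι := rfl

/-- A family of opens `W i ⊆ U` covering `U` generates a covering sieve of `U` in `X_proét`: a
Zariski cover is an étale cover is a pro-étale cover (Bhatt–Scholze Def. 4.1.1; Mathlib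
`etalePrecoverage_le_proetalePrecoverage`, `precoverage_mono`). [cite: BhattScholze2015, Def. 4.1.1] -/
theorem ofArrows_proetOfOpensι_mem (U : X.ProEt) {ι : Type*} (W : ι → U.left.Opens)
    (hW : ∀ x : U.left, ∃ i, x ∈ W i) :
    Sieve.ofArrows _ (fun i => proetOfOpensι U (W i)) ∈ Scheme.ProEt.topology X U := by
  apply Precoverage.generate_mem_toGrothendieck
  rw [Scheme.ProEt.precoverage, Precoverage.mem_comap_iff, Presieve.map_ofArrows]
  refine Scheme.etalePrecoverage_le_proetalePrecoverage _
    (Scheme.precoverage_mono (P := @IsOpenImmersion) (Q := @Etale)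
      (fun _ _ _ _ => inferInstance) _ ?_)
  rw [Scheme.ofArrows_mem_precoverage_iff]
  refine ⟨fun x => ?_, fun i => ?_⟩
  · obtain ⟨i, hi⟩ := hW x
    refine ⟨i, ?_⟩
    change x ∈ Set.range (W i).ι
    rwa [Scheme.Opens.range_ι]
  · change IsOpenImmersion (W i).ι
    infer_instance

/-- The fibre `f⁻¹(m)` of a continuous map to a discrete space, as an open of the source scheme.
[folklore] -/
def fibreOpens {S : Scheme.{u}} {M : Type*} [TopologicalSpace M] [DiscreteTopology M]
    (f : C(S, M)) (m : M) : S.Opens :=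
  ⟨f ⁻¹' {m}, (isOpen_discrete {m}).preimage f.continuous⟩

/-- Membership in the fibre open: `x ∈ f⁻¹(m) ↔ f x = m`. [folklore] -/
@[simp] theorem mem_fibreOpens {S : Scheme.{u}} {M : Type*} [TopologicalSpace M]
    [DiscreteTopology M] (f : C(S, M)) (m : M) (x : S) : x ∈ fibreOpens f m ↔ f x = m :=
  Iff.rfl

end Opens

/-! ### Bhatt–Scholze Lemma 4.2.12: the constant sheaf of a discrete group is `F_M` -/

section Constant

variable (X : Scheme.{u}) (M : Type) [AddCommGroup M] [TopologicalSpace M] [DiscreteTopology M]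

/-- The morphism of presheaves on `X_proét` from the constant presheaf `M` to
`F_M : U ↦ C(U, M)` (lifted to `Ab.{u+1}`) sending `m` to the constant map with value `m`; its
sheafification is the comparison map of Bhatt–Scholze Lemma 4.2.12.
[cite: BhattScholze2015, Lemma 4.2.12] -/
def constToContinuousMapProetSheaf :
    (Functor.const (X.ProEt)ᵒᵖ).obj (AddCommGrpCat.of (ULift.{u + 1} M)) ⟶
      ((sheafCompose (Scheme.ProEt.topology X) AddCommGrpCat.uliftFunctor.{u + 1}).obj
        (continuousMapProetSheaf X M)).obj where
  app U := AddCommGrpCat.ofHom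
    { toFun := fun m => ULift.up (ContinuousMap.const _ m.down)
      map_zero' := rfl
      map_add' := fun _ _ => rfl }
  naturality U V f := by
    ext m
    rfl

/-- On sections over `U`, `constToContinuousMapProetSheaf` is `m ↦ (u ↦ m)` (by `rfl`). [folklore] -/
theorem constToContinuousMapProetSheaf_app_apply (U : (X.ProEt)ᵒᵖ) (m : ULift.{u + 1} M) :
    ((constToContinuousMapProetSheaf X M).app U m : ULift.{u + 1} C(U.unop.left, M)) =
      ULift.up (ContinuousMap.const _ m.down) :=
  rfl

/-- `m ↦ (constant map m)` is **locally injective** on `X_proét`: over a non-empty `U` it is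
injective outright, and the empty `U` is covered by the empty family
(Mathlib `Scheme.ProEt.bot_mem_topology`). [cite: BhattScholze2015, Lemma 4.2.12] -/
theorem isLocallyInjective_constToContinuousMapProetSheaf :
    Presheaf.IsLocallyInjective (Scheme.ProEt.topology X)
      (constToContinuousMapProetSheaf X M) where
  equalizerSieve_mem {U} x y h := by
    by_cases hU : Nonempty U.unop.left
    · obtain ⟨p⟩ := hU
      have hxy : x = y :=
        ULift.ext x y (congrArg (fun s : ULift.{u + 1} C(U.unop.left, M) => s.down p) h)
      subst hxy
      have : Presheaf.equalizerSieve x x = ⊤ := by ext V f; simp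
      rw [this]
      exact GrothendieckTopology.top_mem _ _
    · rw [not_nonempty_iff] at hU
      exact GrothendieckTopology.superset_covering _ bot_le (Scheme.ProEt.bot_mem_topology U.unop)

/-- `m ↦ (constant map m)` is **locally surjective** on `X_proét`: a continuous map `f : U → M`
to the discrete `M` is constant (equal to `m`) on each fibre `f⁻¹(m)`, and the fibres form a
Zariski (hence pro-étale) cover of `U` (`ofArrows_proetOfOpensι_mem`).
[cite: BhattScholze2015, Lemma 4.2.12] -/
theorem isLocallySurjective_constToContinuousMapProetSheaf :
    Presheaf.IsLocallySurjective (Scheme.ProEt.topology X)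
      (constToContinuousMapProetSheaf X M) where
  imageSieve_mem {U} s := by
    refine GrothendieckTopology.superset_covering _ ?_
      (ofArrows_proetOfOpensι_mem U (fibreOpens (ULift.down s)) fun x => ⟨_, rfl⟩)
    rw [Sieve.ofArrows, Sieve.generate_le_iff]
    rintro _ _ ⟨m⟩
    refine ⟨ULift.up m, ?_⟩
    apply ULift.ext
    refine ContinuousMap.ext ?_
    rintro ⟨p, hp⟩
    exact hp.symm

/-- Hence `constToContinuousMapProetSheaf` becomes an isomorphism after sheafification
(`J.W`; Mathlib `GrothendieckTopology.W_of_isLocallyBijective`, the pro-étale topology on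
`X.ProEt` satisfying `WEqualsLocallyBijective` for `Ab.{u+1}`). [cite: BhattScholze2015, Lemma 4.2.12] -/
theorem W_constToContinuousMapProetSheaf :
    (Scheme.ProEt.topology X).W (constToContinuousMapProetSheaf X M) :=
  haveI := isLocallyInjective_constToContinuousMapProetSheaf X M
  haveI := isLocallySurjective_constToContinuousMapProetSheaf X M
  GrothendieckTopology.W_of_isLocallyBijective _ _

/-- The sheafification of `constToContinuousMapProetSheaf`, an isomorphism of sheaves
`(M)^sh ≅ (F_M)^sh`. [cite: BhattScholze2015, Lemma 4.2.12] -/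
def sheafifyConstToContinuousMapProetSheafIso :
    (presheafToSheaf (Scheme.ProEt.topology X) Ab.{u + 1}).obj
        ((Functor.const (X.ProEt)ᵒᵖ).obj (AddCommGrpCat.of (ULift.{u + 1} M))) ≅
      (presheafToSheaf (Scheme.ProEt.topology X) Ab.{u + 1}).obj
        ((sheafCompose (Scheme.ProEt.topology X) AddCommGrpCat.uliftFunctor.{u + 1}).obj
          (continuousMapProetSheaf X M)).obj :=
  letI : IsIso ((presheafToSheaf (Scheme.ProEt.topology X) Ab.{u + 1}).map
      (constToContinuousMapProetSheaf X M)) :=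
    (GrothendieckTopology.W_iff _ _).1 (W_constToContinuousMapProetSheaf X M)
  asIso ((presheafToSheaf (Scheme.ProEt.topology X) Ab.{u + 1}).map
    (constToContinuousMapProetSheaf X M))

/-- **Bhatt–Scholze Lemma 4.2.12 (last sentence), proved**: for a discrete abelian group `M`, the
constant sheaf `M_X` on the small pro-étale site of `X` (Mathlib `constantSheaf`, the
sheafification of the constant presheaf, with values `ULift M ∈ Ab.{u+1}`) is canonically
isomorphic to the sheaf of locally constant (= continuous) maps `F_M : U ↦ C(U, M)` (Mathlib's
`ellAdicSheaf` construction with coefficients `M`, lifted to `Ab.{u+1}`): the composite of the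
sheafified comparison map with the identification of the sheaf `F_M` with its own sheafification
(Mathlib `sheafificationIso`). [cite: BhattScholze2015, Lemma 4.2.12] -/
def constantSheafIsoContinuousMapProetSheaf :
    (constantSheaf (Scheme.ProEt.topology X) Ab.{u + 1}).obj
        (AddCommGrpCat.of (ULift.{u + 1} M)) ≅
      (sheafCompose (Scheme.ProEt.topology X) AddCommGrpCat.uliftFunctor.{u + 1}).obj
        (continuousMapProetSheaf X M) :=
  sheafifyConstToContinuousMapProetSheafIso X M ≪≫ (sheafificationIso _).symm

/-- **`Hⁱ(X_proét, F_M) ≃+ Hⁱ(X_proét, M_X)`**: the pro-étale cohomology of `X` with coefficients in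
the sheaf of continuous maps to a discrete abelian group `M` (`ProetCohomology X M i`, the carrier
of the finiteness fact `finite_proetCohomology_zmod_of_isProper`) is the cohomology of the constant
sheaf `M_X` (Mathlib `Sheaf.H` of `constantSheaf _ _ (ULift M)`), by transport along
`constantSheafIsoContinuousMapProetSheaf` (Bhatt–Scholze Lemma 4.2.12). This is the form to which
the comparison `Hⁱ(X_proét, ν* K) = Hⁱ(X_ét, K)` (Cor. 5.1.6 / Cor. 5.1.9) applies.
[cite: BhattScholze2015, Lemma 4.2.12] -/
def proetCohomologyEquivConstantSheafH (i : ℕ) :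
    ProetCohomology X M i ≃+
      ((constantSheaf (Scheme.ProEt.topology X) Ab.{u + 1}).obj
        (AddCommGrpCat.of (ULift.{u + 1} M))).H i :=
  (addEquivHOfIso (constantSheafIsoContinuousMapProetSheaf X M) i).symm

/-- In particular `Hⁱ_proét(X, ℤ/n)` with coefficients `F_{ℤ/n}` and with coefficients the constant
sheaf `ℤ/n` have the same cardinality / finiteness. [cite: BhattScholze2015, Lemma 4.2.12] -/
theorem finite_proetCohomology_iff_finite_constantSheafH (i : ℕ) :
    Finite (ProetCohomology X M i) ↔
      Finite (((constantSheaf (Scheme.ProEt.topology X) Ab.{u + 1}).obj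
        (AddCommGrpCat.of (ULift.{u + 1} M))).H i) :=
  ⟨fun _ => Finite.of_equiv _ (proetCohomologyEquivConstantSheafH X M i).toEquiv,
    fun _ => Finite.of_equiv _ (proetCohomologyEquivConstantSheafH X M i).toEquiv.symm⟩

end Constant

end Literature.AlgebraicGeometry.Motives

end
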